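import Summits.MatrixMultiplication.MatrixMultiplication.Theorems.ObstructionDescentSplitBoundary

set_option linter.dupNamespace false

/-!
# Obstruction descent, part Y — SLOT SYMMETRY: the action of `S₃` by permuting the three tensor legs

`route-MatrixMultiplication-ObstructionDescent`, aside `InvariantSaturation` (stmt 32282); decomp-mm lens-3, NODE-g16; the
«slotPerm API» named as a kernel leaf by NODE-g15 §3 / census I45 (prerequisite for the slot-character side of H20/H21).
`S₃ = Equiv.Perm (Fin 3)` acts on the cubic format `ℂ^m ⊗ ℂ^m ⊗ ℂ^m` by permuting the legs: on index triples
`slotPerm σ p = (p_{σ0}, p_{σ1}, p_{σ2})`, on tensors `(permT σ t)(a) = t(a_{σ0}, a_{σ1}, a_{σ2})`, on polynomial functions by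
`rename (slotPerm σ)`, with `f^σ(t) = f(permT σ t)` (`evalT_rename_slotPerm`).  The dictionary proved here:
* §1 action laws (`permT_permT`, `slotPerm_slotPerm`, inverses, additivity, the transposition `0 ↔ 1` in coordinates);
* §2 EQUIVARIANCE: triads go to triads with permuted factors (`permT_triad`), so `R(permT σ t) = R(t)` (`tensorRank_permT`);
  the `GL_m³`-action is intertwined with the permuted matrix triple (`permT_actTensor`); the unit tensor and the block-diagonal
  shape are slot-symmetric (`permT_unitTensor`, `permT_mem_blockDiag`);
* §3 TYPES: `rename (slotPerm σ)` maps weight vectors of type `(λ⁽⁰⁾,λ⁽¹⁾,λ⁽²⁾)` to weight vectors of type `s ↦ λ⁽σ s⁾`, same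
  degree (`rename_slotPerm_mem_hwvSpace`); the diagonal types `((k^N))³` of the invariant tower are slot-stable, so every
  level space `R_k(N)` is an `S₃`-module (`rename_slotPerm_mem_level`); orbit ideals, point levels `E′_N(t)` and the
  occurrence order are slot-invariant (`rename_slotPerm_mem_orbitVanishing_iff`, `pointLevels_permT`,
  `level_le_orbitVanishing_permT_iff`);
* §4 SLOT CHARACTERS: on a slot-stable line every vector is a `σ`-eigenvector (`exists_slotChar_of_dim_le_one` — the census's
  `χ_F(N) ∈ {triv, sgn}` on the one-dimensional `R₃(N)`), involutions have characters `±1` (`slotChar_eq_one_or_neg_one`), and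
  the **SLOT-CHARACTER WINDOW RULE H21** in abstract form (`slotChar_eq_mul_of_factorization`, block windows:
  `slotChar_eq_mul_of_blockDiag_factorization`): a factorisation `F = c·g·h` on a slot-stable set of tensors with `F, g, h`
  slot-eigenvectors of characters `χ, χ₁, χ₂`, `c ≠ 0`, `g·h ≢ 0` there forces `χ = χ₁χ₂`; contrapositively a character
  mismatch KILLS the window constant (`window_dead_of_slotChar_ne`) — the mechanism behind the dead windows of record
  `c₄₁(H₅) = 0`, `c₄₄(K₈) = 0` (census I42/I45; the character values themselves are `S_{3N}`-character facts, hypotheses here).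

[cite: BurgisserIkenmeyer2011, §3.1–3.2] (weight vectors and types under `GL_m³`), [cite: BurgisserIkenmeyer2017, §5 (5.2),
Thm 5.3] (levels of a point), [cite: LandsbergGCT2017, §2.1, §8.3] (tensors, symmetry under permutation of the factors).
-/

noncomputable section

open scoped BigOperators
open Finset

namespace Summit.MatrixMultiplication.MatrixMultiplication.Theorems.ObstructionCalculus

open Literature.Computability.AlgebraicComplexity (actTensor actTensor_triad triad triad_apply tensorRank unitTensor
  unitTensor_apply exists_eq_sum_triad_of_tensorRank_le tensorRank_le_of_eq_sum)

variable {m : ℕ}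

/-! ### §1 The action of `S₃` on index triples, tensors and polynomial functions -/

/-- Slot permutation of an index triple: `(slotPerm σ p)_j = p_{σ j}`. [bookkeeping] -/
def slotPerm (σ : Equiv.Perm (Fin 3)) (p : Idx m) : Idx m := (slot (σ 0) p, slot (σ 1) p, slot (σ 2) p)

/-- The induced action on tensors: `(permT σ t)(a₀,a₁,a₂) = t(a_{σ0}, a_{σ1}, a_{σ2})` — the legs of `t` are permuted.
[cite: LandsbergGCT2017, §2.1] -/
def permT (σ : Equiv.Perm (Fin 3)) (t : Tensor ℂ m) : Tensor ℂ m := fun a b c =>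
  t (slot (σ 0) (a, b, c)) (slot (σ 1) (a, b, c)) (slot (σ 2) (a, b, c))

/-- Slots of a permuted triple. [bookkeeping] -/
@[simp] theorem slot_slotPerm (σ : Equiv.Perm (Fin 3)) (j : Fin 3) (p : Idx m) :
    slot j (slotPerm σ p) = slot (σ j) p := by
  fin_cases j <;> rfl

/-- Index triples are determined by their slots. [bookkeeping] -/
theorem ext_slot {p q : Idx m} (h : ∀ j : Fin 3, slot j p = slot j q) : p = q :=
  Prod.ext (h 0) (Prod.ext (h 1) (h 2))

/-- The identity permutation acts trivially on triples. [bookkeeping] -/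
@[simp] theorem slotPerm_one (p : Idx m) : slotPerm 1 p = p := rfl

/-- Composition law on triples (a right action): `slotPerm σ ∘ slotPerm τ = slotPerm (τ * σ)`. [bookkeeping] -/
theorem slotPerm_slotPerm (σ τ : Equiv.Perm (Fin 3)) (p : Idx m) :
    slotPerm σ (slotPerm τ p) = slotPerm (τ * σ) p :=
  ext_slot fun j => by simp only [slot_slotPerm, Equiv.Perm.mul_apply]

/-- Entries of a permuted tensor. [bookkeeping] -/
theorem permT_apply (σ : Equiv.Perm (Fin 3)) (t : Tensor ℂ m) (a b c : Fin m) :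
    permT σ t a b c = t (slot (σ 0) (a, b, c)) (slot (σ 1) (a, b, c)) (slot (σ 2) (a, b, c)) := rfl

/-- The identity permutation acts trivially on tensors. [bookkeeping] -/
@[simp] theorem permT_one (t : Tensor ℂ m) : permT 1 t = t := rfl

/-- Composition law on tensors (a left action): `permT σ ∘ permT τ = permT (σ * τ)`. [bookkeeping] -/
theorem permT_permT (σ τ : Equiv.Perm (Fin 3)) (t : Tensor ℂ m) : permT σ (permT τ t) = permT (σ * τ) t := by
  funext a b c
  show t (slot (τ 0) (slotPerm σ (a, b, c))) (slot (τ 1) (slotPerm σ (a, b, c)))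
      (slot (τ 2) (slotPerm σ (a, b, c))) = _
  simp only [slot_slotPerm, permT_apply, Equiv.Perm.mul_apply]

/-- `σ⁻¹` undoes `σ` on tensors. [bookkeeping] -/
@[simp] theorem permT_inv_permT (σ : Equiv.Perm (Fin 3)) (t : Tensor ℂ m) : permT σ⁻¹ (permT σ t) = t := by
  rw [permT_permT, inv_mul_cancel, permT_one]

/-- `σ` undoes `σ⁻¹` on tensors. [bookkeeping] -/
@[simp] theorem permT_permT_inv (σ : Equiv.Perm (Fin 3)) (t : Tensor ℂ m) : permT σ (permT σ⁻¹ t) = t := by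
  rw [permT_permT, mul_inv_cancel, permT_one]

/-- The slot action is additive. [bookkeeping] -/
theorem permT_add (σ : Equiv.Perm (Fin 3)) (s t : Tensor ℂ m) : permT σ (s + t) = permT σ s + permT σ t := by
  funext a b c; rfl

/-- The slot action commutes with scalars. [bookkeeping] -/
theorem permT_smul (σ : Equiv.Perm (Fin 3)) (c : ℂ) (t : Tensor ℂ m) : permT σ (c • t) = c • permT σ t := by
  funext a b c; rfl

/-- The slot action commutes with subtraction. [bookkeeping] -/
theorem permT_sub (σ : Equiv.Perm (Fin 3)) (s t : Tensor ℂ m) : permT σ (s - t) = permT σ s - permT σ t := by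
  funext a b c; rfl

/-- The slot action commutes with finite sums. [bookkeeping] -/
theorem permT_sum {ι : Type*} (σ : Equiv.Perm (Fin 3)) (s : Finset ι) (f : ι → Tensor ℂ m) :
    permT σ (∑ i ∈ s, f i) = ∑ i ∈ s, permT σ (f i) := by
  funext a b c
  simp only [permT_apply, Finset.sum_apply]

/-- **Polynomial functions: `(rename (slotPerm σ) f)(t) = f(permT σ t)`.** [this node] -/
theorem evalT_rename_slotPerm (σ : Equiv.Perm (Fin 3)) (t : Tensor ℂ m) (f : MvPolynomial (Idx m) ℂ) :
    evalT t (MvPolynomial.rename (slotPerm σ) f) = evalT (permT σ t) f := by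
  unfold evalT; rw [MvPolynomial.aeval_rename]; rfl

/-- Composition law on polynomial functions: `rename (slotPerm σ) ∘ rename (slotPerm τ) = rename (slotPerm (τ * σ))`.
[bookkeeping] -/
theorem rename_slotPerm_rename_slotPerm (σ τ : Equiv.Perm (Fin 3)) (f : MvPolynomial (Idx m) ℂ) :
    MvPolynomial.rename (slotPerm σ) (MvPolynomial.rename (slotPerm τ) f) =
      MvPolynomial.rename (slotPerm (τ * σ)) f := by
  rw [MvPolynomial.rename_rename]
  exact congrArg (fun e : Idx m → Idx m => MvPolynomial.rename e f) (funext fun p => slotPerm_slotPerm σ τ p)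

/-- The identity permutation acts trivially on polynomial functions. [bookkeeping] -/
@[simp] theorem rename_slotPerm_one (f : MvPolynomial (Idx m) ℂ) :
    MvPolynomial.rename (slotPerm (1 : Equiv.Perm (Fin 3))) f = f := by
  have h : (slotPerm (1 : Equiv.Perm (Fin 3)) : Idx m → Idx m) = id := funext fun p => slotPerm_one p
  rw [h, MvPolynomial.rename_id_apply]

/-- `σ⁻¹` undoes `σ` on polynomial functions (in the right-action order). [bookkeeping] -/
@[simp] theorem rename_slotPerm_inv_rename (σ : Equiv.Perm (Fin 3)) (f : MvPolynomial (Idx m) ℂ) :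
    MvPolynomial.rename (slotPerm σ⁻¹) (MvPolynomial.rename (slotPerm σ) f) = f := by
  rw [rename_slotPerm_rename_slotPerm, mul_inv_cancel, rename_slotPerm_one]

/-- The transposition of legs `0 ↔ 1` in coordinates: `t ↦ t(b,a,c)`. [bookkeeping] -/
theorem permT_swap_zero_one (t : Tensor ℂ m) : permT (Equiv.swap 0 1) t = fun a b c => t b a c := by
  funext a b c
  rw [permT_apply, Equiv.swap_apply_left, Equiv.swap_apply_right,
    Equiv.swap_apply_of_ne_of_ne (by decide) (by decide)]
  rfl

/-! ### §2 Equivariance: triads, rank, the `GL_m³`-action, the unit tensor, block-diagonal tensors -/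

/-- **Triads go to triads with permuted factors:** `permT σ (u₀⊗u₁⊗u₂) = u_{σ⁻¹0} ⊗ u_{σ⁻¹1} ⊗ u_{σ⁻¹2}`. [this node] -/
theorem permT_triad (σ : Equiv.Perm (Fin 3)) (u : Fin 3 → Fin m → ℂ) :
    permT σ (triad (u 0) (u 1) (u 2)) = triad (u (σ.symm 0)) (u (σ.symm 1)) (u (σ.symm 2)) := by
  funext a b c
  rw [permT_apply, triad_apply, triad_apply]
  have h1 : u 0 (slot (σ 0) (a, b, c)) * u 1 (slot (σ 1) (a, b, c)) * u 2 (slot (σ 2) (a, b, c)) =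
      ∏ s : Fin 3, u s (slot (σ s) (a, b, c)) :=
    (Fin.prod_univ_three fun s => u s (slot (σ s) (a, b, c))).symm
  have h2 : ∏ s : Fin 3, u s (slot (σ s) (a, b, c)) = ∏ j : Fin 3, u (σ.symm j) (slot j (a, b, c)) :=
    Fintype.prod_equiv σ _ _ fun s => by rw [Equiv.symm_apply_apply]
  rw [h1, h2, Fin.prod_univ_three, slot_zero, slot_one, slot_two]

/-- **The rank is slot-invariant** (one inequality). [this node] -/
theorem tensorRank_permT_le (σ : Equiv.Perm (Fin 3)) (t : Tensor ℂ m) : tensorRank (permT σ t) ≤ tensorRank t := by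
  obtain ⟨w, u, v, h⟩ := exists_eq_sum_triad_of_tensorRank_le (le_refl (tensorRank t))
  refine tensorRank_le_of_eq_sum (fun i => ![w i, u i, v i] (σ.symm 0)) (fun i => ![w i, u i, v i] (σ.symm 1))
    (fun i => ![w i, u i, v i] (σ.symm 2)) ?_
  have e : permT σ t = permT σ (∑ i, triad (w i) (u i) (v i)) := by rw [← h]
  rw [e, permT_sum]
  exact Finset.sum_congr rfl fun i _ => permT_triad σ ![w i, u i, v i]

/-- **`R(permT σ t) = R(t)`.** [this node] -/
theorem tensorRank_permT (σ : Equiv.Perm (Fin 3)) (t : Tensor ℂ m) : tensorRank (permT σ t) = tensorRank t :=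
  le_antisymm (tensorRank_permT_le σ t)
    (by simpa only [permT_inv_permT] using tensorRank_permT_le σ⁻¹ (permT σ t))

/-- **The slot action intertwines the `GL_m³`-action with the permuted triple of matrices:**
`permT σ ((M₀,M₁,M₂)·t) = (M_{σ⁻¹0}, M_{σ⁻¹1}, M_{σ⁻¹2})·(permT σ t)`. [this node] -/
theorem permT_actTensor (σ : Equiv.Perm (Fin 3)) (M : Fin 3 → Matrix (Fin m) (Fin m) ℂ) (t : Tensor ℂ m) :
    permT σ (actTensor (M 0) (M 1) (M 2) t) =
      actTensor (M (σ.symm 0)) (M (σ.symm 1)) (M (σ.symm 2)) (permT σ t) := by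
  obtain ⟨w, u, v, h⟩ := exists_eq_sum_triad_of_tensorRank_le (le_refl (tensorRank t))
  have e : permT σ (actTensor (M 0) (M 1) (M 2) t) =
      permT σ (actTensor (M 0) (M 1) (M 2) (∑ i, triad (w i) (u i) (v i))) := by rw [← h]
  have e' : permT σ t = permT σ (∑ i, triad (w i) (u i) (v i)) := by rw [← h]
  rw [e, e', actTensor_finset_sum', permT_sum, permT_sum, actTensor_finset_sum']
  refine Finset.sum_congr rfl fun i _ => ?_
  have h2 : permT σ (triad (w i) (u i) (v i)) =
      triad (![w i, u i, v i] (σ.symm 0)) (![w i, u i, v i] (σ.symm 1)) (![w i, u i, v i] (σ.symm 2)) :=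
    permT_triad σ ![w i, u i, v i]
  have h1 : permT σ (triad ((M 0).mulVec (w i)) ((M 1).mulVec (u i)) ((M 2).mulVec (v i))) =
      triad ((fun j => (M j).mulVec (![w i, u i, v i] j)) (σ.symm 0))
        ((fun j => (M j).mulVec (![w i, u i, v i] j)) (σ.symm 1))
        ((fun j => (M j).mulVec (![w i, u i, v i] j)) (σ.symm 2)) :=
    permT_triad σ fun j => (M j).mulVec (![w i, u i, v i] j)
  rw [actTensor_triad, h1, h2, actTensor_triad]

/-- **The unit tensor `⟨m⟩` is slot-symmetric.** [this node] -/
theorem permT_unitTensor (σ : Equiv.Perm (Fin 3)) : permT σ (unitTensor ℂ m) = unitTensor ℂ m := by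
  funext a b c
  rw [permT_apply, unitTensor_apply, unitTensor_apply]
  have e1 : ∀ τ : Equiv.Perm (Fin 3), (slot (τ 0) (a, b, c) = slot (τ 1) (a, b, c) ∧
      slot (τ 1) (a, b, c) = slot (τ 2) (a, b, c)) → ∀ i j : Fin 3, slot i (a, b, c) = slot j (a, b, c) := by
    intro τ h i j
    have hc : ∀ s : Fin 3, slot (τ s) (a, b, c) = slot (τ 0) (a, b, c) :=
      forall_fin_three.2 ⟨rfl, h.1.symm, (h.1.trans h.2).symm⟩
    rw [← τ.apply_symm_apply i, ← τ.apply_symm_apply j, hc (τ.symm i), hc (τ.symm j)]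
  have key : (slot (σ 0) (a, b, c) = slot (σ 1) (a, b, c) ∧ slot (σ 1) (a, b, c) = slot (σ 2) (a, b, c)) ↔
      (a = b ∧ b = c) :=
    ⟨fun h => ⟨e1 σ h 0 1, e1 σ h 1 2⟩, fun h => ⟨e1 1 h _ _, e1 1 h _ _⟩⟩
  simp only [key]

/-- **Block-diagonal tensors stay block-diagonal** under the slot action (the shape `x_out ⊞ x_B` is slot-symmetric).
[this node] -/
theorem permT_mem_blockDiag {N₂ : ℕ} (σ : Equiv.Perm (Fin 3)) {x : Tensor ℂ m} (hx : x ∈ blockDiag m N₂) :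
    permT σ x ∈ blockDiag m N₂ := by
  refine mem_blockDiag.2 fun a b c hne => ?_
  rw [permT_apply] at hne
  have key : ∀ P : Fin m → Prop, (P (slot (σ 0) (a, b, c)) ∧ P (slot (σ 1) (a, b, c)) ∧ P (slot (σ 2) (a, b, c))) →
      P a ∧ P b ∧ P c := by
    intro P hP
    have h3 : ∀ j : Fin 3, P (slot (σ j) (a, b, c)) := forall_fin_three.2 hP
    have h3' : ∀ j : Fin 3, P (slot j (a, b, c)) := fun j => by
      simpa only [Equiv.apply_symm_apply] using h3 (σ.symm j)
    exact ⟨h3' 0, h3' 1, h3' 2⟩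
  exact (mem_blockDiag.1 hx _ _ _ hne).imp (key fun i => m ≤ (i : ℕ) + N₂) (key fun i => ¬ m ≤ (i : ℕ) + N₂)

/-! ### §3 Types, level spaces, orbit ideals and point levels under the slot action -/

/-- **Weight vectors go to weight vectors of the permuted type:** if `f` has type `Λ = (λ⁽⁰⁾,λ⁽¹⁾,λ⁽²⁾)` in degree `d`, then
`rename (slotPerm σ) f` has type `s ↦ λ⁽σ s⁾` in degree `d`. [this node] -/
theorem rename_slotPerm_mem_hwvSpace {Λ : Fin 3 → Fin m → ℕ} {d : ℕ} {f : MvPolynomial (Idx m) ℂ}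
    (hf : f ∈ hwvSpace Λ d) (σ : Equiv.Perm (Fin 3)) :
    MvPolynomial.rename (slotPerm σ) f ∈ hwvSpace (fun s => Λ (σ s)) d := by
  refine ⟨hf.1.rename_isHomogeneous, fun A B C hA hB hC t => ?_⟩
  rw [evalT_rename_slotPerm, evalT_rename_slotPerm]
  have hM : ∀ j : Fin 3, ![A, B, C] j ∈ borel m := forall_fin_three.2 ⟨hA, hB, hC⟩
  have h' : permT σ (actTensor A B C t) = actTensor (![A, B, C] (σ.symm 0)) (![A, B, C] (σ.symm 1))
      (![A, B, C] (σ.symm 2)) (permT σ t) := permT_actTensor σ ![A, B, C] t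
  rw [h', hf.2 _ _ _ (hM _) (hM _) (hM _) (permT σ t)]
  congr 1
  have key : ∏ j : Fin 3, weightChar (Λ j) (![A, B, C] (σ.symm j)) =
      ∏ s : Fin 3, weightChar (Λ (σ s)) (![A, B, C] s) :=
    Fintype.prod_equiv σ.symm _ _ fun j => by simp only [Equiv.apply_symm_apply]
  rw [Fin.prod_univ_three, Fin.prod_univ_three] at key
  simpa using key

/-- Slot-constant types are slot-stable. [this node] -/
theorem rename_slotPerm_mem_hwvSpace_of_slotConst {Λ : Fin 3 → Fin m → ℕ} {d : ℕ} {f : MvPolynomial (Idx m) ℂ}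
    (hf : f ∈ hwvSpace Λ d) (hΛ : ∀ s s' : Fin 3, Λ s = Λ s') (σ : Equiv.Perm (Fin 3)) :
    MvPolynomial.rename (slotPerm σ) f ∈ hwvSpace Λ d := by
  have h := rename_slotPerm_mem_hwvSpace hf σ
  have hΛ' : (fun s => Λ (σ s)) = Λ := funext fun s => hΛ _ _
  rwa [hΛ'] at h

/-- **Every level space `R_k(N)` (type `((k^N))³`, degree `kN`, at any ambient format) is an `S₃`-module.** [this node] -/
theorem rename_slotPerm_mem_level {N k : ℕ} {f : MvPolynomial (Idx m) ℂ}
    (hf : f ∈ hwvSpace (rectType m N k) (k * N)) (σ : Equiv.Perm (Fin 3)) :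
    MvPolynomial.rename (slotPerm σ) f ∈ hwvSpace (rectType m N k) (k * N) :=
  rename_slotPerm_mem_hwvSpace_of_slotConst hf (fun _ _ => rfl) σ

/-- **Orbit ideals are slot-equivariant:** `f^σ ∈ I(GL³·t) ⟺ f ∈ I(GL³·permT σ t)`. [this node] -/
theorem rename_slotPerm_mem_orbitVanishing_iff (σ : Equiv.Perm (Fin 3)) (t : Tensor ℂ m)
    (f : MvPolynomial (Idx m) ℂ) :
    MvPolynomial.rename (slotPerm σ) f ∈ orbitVanishing t ↔ f ∈ orbitVanishing (permT σ t) := by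
  constructor
  · intro h A B C hA hB hC
    have hdet : ∀ j : Fin 3, (![A, B, C] j).det ≠ 0 := forall_fin_three.2 ⟨hA, hB, hC⟩
    have key := permT_actTensor σ (fun s => ![A, B, C] (σ s)) t
    simp only [Equiv.apply_symm_apply, Matrix.cons_val_zero, Matrix.cons_val_one, Matrix.cons_val_two,
      Matrix.head_cons, Matrix.tail_cons] at key
    rw [← key, ← evalT_rename_slotPerm]
    exact h _ _ _ (hdet _) (hdet _) (hdet _)
  · intro h A B C hA hB hC
    have hdet : ∀ j : Fin 3, (![A, B, C] j).det ≠ 0 := forall_fin_three.2 ⟨hA, hB, hC⟩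
    have h1 : permT σ (actTensor A B C t) = actTensor (![A, B, C] (σ.symm 0)) (![A, B, C] (σ.symm 1))
        (![A, B, C] (σ.symm 2)) (permT σ t) := permT_actTensor σ ![A, B, C] t
    rw [evalT_rename_slotPerm, h1]
    exact h _ _ _ (hdet _) (hdet _) (hdet _)

/-- **Point levels are slot-invariant:** `E′_N(permT σ t) = E′_N(t)`. [this node] -/
theorem pointLevels_permT (N : ℕ) (σ : Equiv.Perm (Fin 3)) (t : Tensor ℂ m) :
    pointLevels N (permT σ t) = pointLevels N t := by
  ext k
  constructor
  · rintro ⟨f, hf, hne⟩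
    exact ⟨_, rename_slotPerm_mem_level hf σ, by rwa [evalT_rename_slotPerm]⟩
  · rintro ⟨f, hf, hne⟩
    refine ⟨_, rename_slotPerm_mem_level hf σ⁻¹, ?_⟩
    rwa [evalT_rename_slotPerm, permT_inv_permT]

/-- **The occurrence order is slot-invariant:** level `k` of block format `N` lies in `I(GL³·permT σ u)` iff it lies in
`I(GL³·u)`. [this node] -/
theorem level_le_orbitVanishing_permT_iff {N k : ℕ} (σ : Equiv.Perm (Fin 3)) (u : Tensor ℂ m) :
    hwvSpace (rectType m N k) (k * N) ≤ orbitVanishing (permT σ u) ↔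
      hwvSpace (rectType m N k) (k * N) ≤ orbitVanishing u := by
  constructor
  · intro H f hf
    have h := H (rename_slotPerm_mem_level hf σ⁻¹)
    rwa [rename_slotPerm_mem_orbitVanishing_iff, permT_inv_permT] at h
  · intro H f hf
    exact (rename_slotPerm_mem_orbitVanishing_iff σ u f).1 (H (rename_slotPerm_mem_level hf σ))

/-! ### §4 Slot characters and the slot-character window rule (H21) -/

/-- **Slot characters exist on a slot-stable line:** if `V ⊆ ℂ·f₀` is stable under `rename (slotPerm σ)`, every `f ∈ V` is a
`σ`-eigenvector. (For the one-dimensional level spaces `R₃(N)` this is the census's slot character `χ_F(N)`.) [this node] -/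
theorem exists_slotChar_of_dim_le_one (σ : Equiv.Perm (Fin 3)) {V : Submodule ℂ (MvPolynomial (Idx m) ℂ)}
    {f₀ : MvPolynomial (Idx m) ℂ} (hV : ∀ g ∈ V, ∃ c : ℂ, g = c • f₀)
    (hstab : ∀ g ∈ V, MvPolynomial.rename (slotPerm σ) g ∈ V) {f : MvPolynomial (Idx m) ℂ} (hf : f ∈ V) :
    ∃ χ : ℂ, MvPolynomial.rename (slotPerm σ) f = χ • f := by
  obtain ⟨c, hc⟩ := hV f hf
  obtain ⟨c', hc'⟩ := hV _ (hstab f hf)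
  by_cases h0 : c = 0
  · refine ⟨0, ?_⟩
    rw [hc, h0, zero_smul, map_zero, smul_zero]
  · refine ⟨c' / c, ?_⟩
    rw [hc', hc, smul_smul, div_mul_cancel₀ c' h0]

/-- Slot characters of a level space spanned by one vector. [this node] -/
theorem exists_slotChar_level {N k : ℕ} (σ : Equiv.Perm (Fin 3)) {f₀ : MvPolynomial (Idx m) ℂ}
    (hV : ∀ g ∈ hwvSpace (rectType m N k) (k * N), ∃ c : ℂ, g = c • f₀) {f : MvPolynomial (Idx m) ℂ}
    (hf : f ∈ hwvSpace (rectType m N k) (k * N)) : ∃ χ : ℂ, MvPolynomial.rename (slotPerm σ) f = χ • f :=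
  exists_slotChar_of_dim_le_one σ hV (fun _ hg => rename_slotPerm_mem_level hg σ) hf

/-- **An involution has slot characters `±1`:** `σ² = 1`, `f^σ = χ f`, `f ≠ 0` ⇒ `χ² = 1`. [this node] -/
theorem slotChar_sq_eq_one {σ : Equiv.Perm (Fin 3)} (hσ : σ * σ = 1) {f : MvPolynomial (Idx m) ℂ} {χ : ℂ}
    (hf : MvPolynomial.rename (slotPerm σ) f = χ • f) (hf0 : f ≠ 0) : χ * χ = 1 := by
  have h : MvPolynomial.rename (slotPerm σ) (MvPolynomial.rename (slotPerm σ) f) = f := by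
    rw [rename_slotPerm_rename_slotPerm, hσ, rename_slotPerm_one]
  rw [hf, map_smul, hf, smul_smul] at h
  have h2 : (χ * χ - 1) • f = 0 := by rw [sub_smul, one_smul, h, sub_self]
  rcases smul_eq_zero.1 h2 with h3 | h3
  · exact sub_eq_zero.1 h3
  · exact absurd h3 hf0

/-- … hence `χ = 1` or `χ = −1` (`triv` or `sgn` on a transposition). [this node] -/
theorem slotChar_eq_one_or_neg_one {σ : Equiv.Perm (Fin 3)} (hσ : σ * σ = 1) {f : MvPolynomial (Idx m) ℂ} {χ : ℂ}
    (hf : MvPolynomial.rename (slotPerm σ) f = χ • f) (hf0 : f ≠ 0) : χ = 1 ∨ χ = -1 :=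
  mul_self_eq_one_iff.1 (slotChar_sq_eq_one hσ hf hf0)

/-- Values of a slot-eigenvector at permuted tensors. [bookkeeping] -/
theorem evalT_permT_of_slotChar (σ : Equiv.Perm (Fin 3)) {f : MvPolynomial (Idx m) ℂ} {χ : ℂ}
    (hf : MvPolynomial.rename (slotPerm σ) f = χ • f) (x : Tensor ℂ m) : evalT (permT σ x) f = χ * evalT x f := by
  rw [← evalT_rename_slotPerm, hf, map_smul, smul_eq_mul]

/-- **THE SLOT-CHARACTER WINDOW RULE (H21), abstract form.**  Let `S` be a slot-stable set of tensors on which `F`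
FACTORISES, `F(x) = c·g(x)·h(x)` for `x ∈ S`, with `F, g, h` slot-eigenvectors of `σ` of characters `χ, χ₁, χ₂`.  If `c ≠ 0`
and `g(x)h(x) ≠ 0` for some `x ∈ S`, then `χ = χ₁·χ₂`. [this node] -/
theorem slotChar_eq_mul_of_factorization (σ : Equiv.Perm (Fin 3)) {S : Set (Tensor ℂ m)}
    (hS : ∀ x ∈ S, permT σ x ∈ S) {F g h : MvPolynomial (Idx m) ℂ} {χ χ₁ χ₂ c : ℂ}
    (hF : MvPolynomial.rename (slotPerm σ) F = χ • F) (hg : MvPolynomial.rename (slotPerm σ) g = χ₁ • g)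
    (hh : MvPolynomial.rename (slotPerm σ) h = χ₂ • h)
    (hfac : ∀ x ∈ S, evalT x F = c * (evalT x g * evalT x h)) (hc : c ≠ 0)
    (hne : ∃ x ∈ S, evalT x g ≠ 0 ∧ evalT x h ≠ 0) : χ = χ₁ * χ₂ := by
  obtain ⟨x, hx, hg0, hh0⟩ := hne
  have h1 := hfac _ (hS x hx)
  rw [evalT_permT_of_slotChar σ hF, evalT_permT_of_slotChar σ hg, evalT_permT_of_slotChar σ hh, hfac x hx] at h1
  have hne' : c * (evalT x g * evalT x h) ≠ 0 := mul_ne_zero hc (mul_ne_zero hg0 hh0)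
  have h2 : χ * (c * (evalT x g * evalT x h)) = χ₁ * χ₂ * (c * (evalT x g * evalT x h)) := by
    rw [h1]; ring
  exact mul_right_cancel₀ hne' h2

/-- **Dead windows from a character mismatch** (contrapositive of H21): if `χ ≠ χ₁χ₂`, a factorisation `F = c·g·h` on a
slot-stable set `S` has `c = 0` or `g·h ≡ 0` on `S`. [this node] -/
theorem window_dead_of_slotChar_ne (σ : Equiv.Perm (Fin 3)) {S : Set (Tensor ℂ m)}
    (hS : ∀ x ∈ S, permT σ x ∈ S) {F g h : MvPolynomial (Idx m) ℂ} {χ χ₁ χ₂ c : ℂ}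
    (hF : MvPolynomial.rename (slotPerm σ) F = χ • F) (hg : MvPolynomial.rename (slotPerm σ) g = χ₁ • g)
    (hh : MvPolynomial.rename (slotPerm σ) h = χ₂ • h)
    (hfac : ∀ x ∈ S, evalT x F = c * (evalT x g * evalT x h)) (hχ : χ ≠ χ₁ * χ₂) :
    c = 0 ∨ ∀ x ∈ S, evalT x g = 0 ∨ evalT x h = 0 := by
  by_cases hc : c = 0
  · exact Or.inl hc
  · refine Or.inr fun x hx => ?_
    by_contra hcon
    have h0 : evalT x g ≠ 0 ∧ evalT x h ≠ 0 := not_or.1 hcon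
    exact hχ (slotChar_eq_mul_of_factorization σ hS hF hg hh hfac hc ⟨x, hx, h0.1, h0.2⟩)

/-- **H21 for block windows:** the block-diagonal tensors `x_out ⊞ x_B` (last-`N₂` block) form a slot-stable set, so a
window factorisation `F(x_out ⊞ x_B) = c_F · g(x) · h(x)` with slot characters `χ_F ≠ χ_g χ_h` is DEAD (`c_F = 0`) as soon
as `g·h ≢ 0` on block-diagonal tensors. [this node] -/
theorem slotChar_eq_mul_of_blockDiag_factorization {N₂ : ℕ} (σ : Equiv.Perm (Fin 3))
    {F g h : MvPolynomial (Idx m) ℂ} {χ χ₁ χ₂ c : ℂ}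
    (hF : MvPolynomial.rename (slotPerm σ) F = χ • F) (hg : MvPolynomial.rename (slotPerm σ) g = χ₁ • g)
    (hh : MvPolynomial.rename (slotPerm σ) h = χ₂ • h)
    (hfac : ∀ x ∈ blockDiag m N₂, evalT x F = c * (evalT x g * evalT x h)) (hc : c ≠ 0)
    (hne : ∃ x ∈ blockDiag m N₂, evalT x g ≠ 0 ∧ evalT x h ≠ 0) : χ = χ₁ * χ₂ :=
  slotChar_eq_mul_of_factorization σ (fun _ hx => permT_mem_blockDiag σ hx) hF hg hh hfac hc hne

end Summit.MatrixMultiplication.MatrixMultiplication.Theorems.ObstructionCalculus
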